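import Summits.BirchSwinnertonDyer.BirchSwinnertonDyer.Theorems.ResidualThetaTransportAtTwoThetaLayerLambdaCongruenceAtTwoCuspSpanEllipticFamilies
import Mathlib.Data.List.Prime
import HarnessLib

/-!
# Route `ResidualThetaTransportAtTwo`, node (G′)_N = `CuspSpanEvenAtTwo N` (item 27436; cruxes Kan⁺ 20688 / Kμ⁺ / 21437):
# the lead's THEOREM A at PRIME-POWER levels `p^e` (`e ≥ 2`) from a primitive root — incl. the census anchor levels
# `4489 = 67²` (4489a1) and, in the sequel, `26569 = 163²` (26569a1)

Cell `bsd-wall`, width seat `bsd-wall-rtt-p3-w3` g7 (2026-08-28). THEOREMS ONLY; `--supports stmt-BirchSwinnertonDyer-20688`; BSD is not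
proved by this. The lead's `cuspSpanEvenAtTwo_of_primePow` (Theorem A, p618977: every unit of `ℤ/p^e` is `±4^k` ⟹ the node) has a
hypothesis whose finite check costs `O(p^e · ord 4)` — out of reach of `decide` at `p^e` in the thousands. Here
(`cuspSpanEvenAtTwo_primePow_of_orderOf_eq_neg_four_pow`) it is discharged from a primitive root: if `g ∈ ℤ/p^e` has order
`φ(p^e)` (so every unit is a power of `g` — a cardinality argument, `ZMod.card_units_eq_totient`) and `g = −4^a`, then every unit is
`g^m = ±4^{am + φ(p^e)}` (`4^{φ} = 1`, Euler). The order of `g` is certified by `g^φ = 1` (Euler) and `g^{φ/q} ≠ 1` for the prime factors `q`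
of `φ` given as an explicit list (`orderOf_eq_of_factorList`). Instances (four `decide +kernel` checks each): the prime powers
`p^e ≤ 30000`, `e ≥ 2`, with `(ℤ/p^e)ˣ = ±⟨4⟩` not yet in the tree — `343, 529, 729, 1331, 2187, 2209, 2401, 3481, 4489, 5041, 6241, 6561,
6859, 6889` here and `10609, 11449, 12167, 14641, 16807, 17161, 19321, 19683, 26569, 27889` in the sequel `…PrimePowerA2` (`243`, `361` are in
the lead's `…CuspSpanCert243`) (the rtt-p4-w2 turnkey
`flatAtTwo_turnkey_prime_level_of_cuspSpanEvenAtTwo` consumes the node AT THE ANCHOR LEVEL: `361`, `4489`, `26569` are anchor levels of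
the TP2/RTT habitat census).

References: R. Pollack, Duke Math. J. 118 (2003) Conj. 6.3 [Pollack2003]; H. Rademacher, Abh. Math. Sem. Hamburg 7 (1929) §1 [Rademacher1929].
-/

set_option autoImplicit false
set_option linter.dupNamespace false

noncomputable section

open scoped MatrixGroups Nat

open CongruenceSubgroup

namespace Summit.BirchSwinnertonDyer.BirchSwinnertonDyer.Theorems.SignedMuAtTwo

/-- `orderOf x = n` from `x^n = 1`, an explicit list `L` of primes with `n = L.prod`, and `x^{n/q} ≠ 1` for `q ∈ L`.
(`decide`-friendly at large `n`.) [folklore] -/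
theorem orderOf_eq_of_factorList {M : Type*} [Monoid M] (x : M) (n : ℕ) (hn : 0 < n) (h1 : x ^ n = 1) (L : List ℕ)
    (hprime : ∀ q ∈ L, q.Prime) (hprod : L.prod = n) (h2 : ∀ q ∈ L, x ^ (n / q) ≠ 1) : orderOf x = n := by
  refine orderOf_eq_of_pow_and_pow_div_prime hn h1 fun q hq hqd ↦ ?_
  rw [← hprod] at hqd
  obtain ⟨r, hr, hqr⟩ := (Prime.dvd_prod_iff (Nat.prime_iff.mp hq)).mp hqd
  have : q = r := (Nat.prime_dvd_prime_iff_eq hq (hprime r hr)).mp hqr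
  subst this
  exact h2 q hr

/-- In `ℤ/N`, an element of order `φ(N)` generates the units: every unit is a power of it. [folklore] -/
theorem exists_pow_eq_of_orderOf_eq_totient {N : ℕ} [NeZero N] {g : ZMod N} (hg : orderOf g = φ N) {u : ZMod N}
    (hu : IsUnit u) : ∃ m : ℕ, u = g ^ m := by
  have hφ : 0 < φ N := Nat.totient_pos.mpr (NeZero.pos N)
  have hgfin : IsOfFinOrder g := orderOf_pos_iff.mp (by rw [hg]; exact hφ)
  obtain ⟨gu, hgu⟩ := hgfin.isUnit
  obtain ⟨uu, huu⟩ := hu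
  have hord : orderOf gu = φ N := by rw [← orderOf_units, hgu, hg]
  have htop : Subgroup.zpowers gu = ⊤ := by
    apply Subgroup.eq_top_of_card_eq
    rw [Nat.card_zpowers, hord, Nat.card_eq_fintype_card, ZMod.card_units_eq_totient]
  have hmem : uu ∈ Submonoid.powers gu := by
    rw [mem_powers_iff_mem_zpowers, htop]; exact Subgroup.mem_top _
  obtain ⟨m, hm⟩ := (Submonoid.mem_powers_iff _ _).mp hmem
  refine ⟨m, ?_⟩
  have := congrArg (fun x : (ZMod N)ˣ ↦ (x : ZMod N)) hm
  simp only [Units.val_pow_eq_pow_val, hgu, huu] at this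
  exact this.symm

/-- **Theorem A at a prime power from a primitive root**: `orderOf g = φ(p^e)`, `g = −4^a`, `4` a unit (`4·c₄ = 1`)
⟹ every unit is `±4^k` with `k ≥ 1` ⟹ `CuspSpanEvenAtTwo (p^e)` (the lead's `cuspSpanEvenAtTwo_of_primePow`).
[cite: Pollack2003, Conj. 6.3] -/
theorem cuspSpanEvenAtTwo_primePow_of_orderOf_eq_neg_four_pow {p : ℕ} (hp : p.Prime) (e : ℕ) [NeZero (p ^ e)]
    (g : ZMod (p ^ e)) (hg : orderOf g = φ (p ^ e)) (a : ℕ) (hga : g = -(4 ^ a)) (c₄ : ZMod (p ^ e))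
    (h4 : 4 * c₄ = 1) : CuspSpanEvenAtTwo (p ^ e) := by
  have h4u : IsUnit (4 : ZMod (p ^ e)) := IsUnit.of_mul_eq_one c₄ h4
  have hF : (4 : ZMod (p ^ e)) ^ φ (p ^ e) = 1 := by
    have := ZMod.pow_totient h4u.unit
    rw [Units.ext_iff, Units.val_pow_eq_pow_val, IsUnit.unit_spec, Units.val_one] at this
    exact this
  have hφ : 1 ≤ φ (p ^ e) := Nat.totient_pos.mpr (NeZero.pos _)
  refine cuspSpanEvenAtTwo_of_primePow hp fun u hu ↦ ?_
  obtain ⟨m, rfl⟩ := exists_pow_eq_of_orderOf_eq_totient hg hu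
  refine ⟨a * m + φ (p ^ e), by omega, ?_⟩
  rcases Nat.even_or_odd m with hm | hm
  · left; rw [hga, hm.neg_pow, ← pow_mul, pow_add, hF, mul_one]
  · right; rw [hga, hm.neg_pow, ← pow_mul, pow_add, hF, mul_one]

/-- **Theorem A at a prime power, certificate form**: `g = −4^a`, `4 c₄ = 1`, the prime factors of `φ(p^e)` as an explicit list `L`,
and `g^{φ/q} ≠ 1` for `q ∈ L` (then `orderOf g = φ(p^e)`: `g^φ = 1` is Euler's theorem) ⟹ `CuspSpanEvenAtTwo (p^e)`.
[cite: Pollack2003, Conj. 6.3] -/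
theorem cuspSpanEvenAtTwo_primePow_of_factorList {p : ℕ} (hp : p.Prime) (e : ℕ) [NeZero (p ^ e)] (g : ZMod (p ^ e)) (a : ℕ)
    (hga : g = -(4 ^ a)) (c₄ : ZMod (p ^ e)) (h4 : 4 * c₄ = 1) (φN : ℕ) (hφ : φ (p ^ e) = φN) (L : List ℕ)
    (hprime : ∀ q ∈ L, q.Prime) (hprod : L.prod = φN) (h2 : ∀ q ∈ L, g ^ (φN / q) ≠ 1) : CuspSpanEvenAtTwo (p ^ e) := by
  have h4u : IsUnit (4 : ZMod (p ^ e)) := IsUnit.of_mul_eq_one c₄ h4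
  have hgu : IsUnit g := by rw [hga]; exact (h4u.pow a).neg
  have h1 : g ^ φN = 1 := by
    have := ZMod.pow_totient hgu.unit
    rw [Units.ext_iff, Units.val_pow_eq_pow_val, IsUnit.unit_spec, Units.val_one, hφ] at this
    exact this
  have hφpos : 0 < φN := by rw [← hφ]; exact Nat.totient_pos.mpr (NeZero.pos _)
  exact cuspSpanEvenAtTwo_primePow_of_orderOf_eq_neg_four_pow hp e g
    (hφ ▸ orderOf_eq_of_factorList g φN hφpos h1 L hprime hprod h2) a hga c₄ h4

/-- `CuspSpanEvenAtTwo 729` (`729 = 3^6`; Theorem A: `2` has order `φ = 486`, `2 = −4^122` in `ℤ/729`). [cite: Pollack2003, Conj. 6.3] -/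
theorem cuspSpanEvenAtTwo_uniform_729 : CuspSpanEvenAtTwo 729 := by
  have h2 : ∀ q ∈ ([2, 3, 3, 3, 3, 3] : List ℕ), (2 : ZMod (3 ^ 6)) ^ (486 / q) ≠ 1 := by decide +kernel
  have hL : ∀ q ∈ ([2, 3, 3, 3, 3, 3] : List ℕ), q.Prime := by decide +kernel
  have hg : (2 : ZMod (3 ^ 6)) = -(4 ^ 122) := by decide +kernel
  have h4 : (4 : ZMod (3 ^ 6)) * 547 = 1 := by decide +kernel
  haveI : NeZero (3 ^ 6) := ⟨by norm_num⟩
  have hφ : φ (3 ^ 6) = 486 := by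
    rw [Nat.totient_prime_pow (by norm_num) (by norm_num : 0 < 6)]; norm_num
  have h : CuspSpanEvenAtTwo (3 ^ 6) :=
    cuspSpanEvenAtTwo_primePow_of_factorList (p := 3) (by norm_num) 6 2 122 hg 547 h4 486 hφ [2, 3, 3, 3, 3, 3] hL (by norm_num) h2
  simpa using h

/-- `CuspSpanEvenAtTwo 2187` (`2187 = 3^7`; Theorem A: `2` has order `φ = 1458`, `2 = −4^365` in `ℤ/2187`). [cite: Pollack2003, Conj. 6.3] -/
theorem cuspSpanEvenAtTwo_uniform_2187 : CuspSpanEvenAtTwo 2187 := by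
  have h2 : ∀ q ∈ ([2, 3, 3, 3, 3, 3, 3] : List ℕ), (2 : ZMod (3 ^ 7)) ^ (1458 / q) ≠ 1 := by decide +kernel
  have hL : ∀ q ∈ ([2, 3, 3, 3, 3, 3, 3] : List ℕ), q.Prime := by decide +kernel
  have hg : (2 : ZMod (3 ^ 7)) = -(4 ^ 365) := by decide +kernel
  have h4 : (4 : ZMod (3 ^ 7)) * 547 = 1 := by decide +kernel
  haveI : NeZero (3 ^ 7) := ⟨by norm_num⟩
  have hφ : φ (3 ^ 7) = 1458 := by
    rw [Nat.totient_prime_pow (by norm_num) (by norm_num : 0 < 7)]; norm_num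
  have h : CuspSpanEvenAtTwo (3 ^ 7) :=
    cuspSpanEvenAtTwo_primePow_of_factorList (p := 3) (by norm_num) 7 2 365 hg 547 h4 1458 hφ [2, 3, 3, 3, 3, 3, 3] hL (by norm_num) h2
  simpa using h

/-- `CuspSpanEvenAtTwo 6561` (`6561 = 3^8`; Theorem A: `2` has order `φ = 4374`, `2 = −4^1094` in `ℤ/6561`). [cite: Pollack2003, Conj. 6.3] -/
theorem cuspSpanEvenAtTwo_uniform_6561 : CuspSpanEvenAtTwo 6561 := by
  have h2 : ∀ q ∈ ([2, 3, 3, 3, 3, 3, 3, 3] : List ℕ), (2 : ZMod (3 ^ 8)) ^ (4374 / q) ≠ 1 := by decide +kernel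
  have hL : ∀ q ∈ ([2, 3, 3, 3, 3, 3, 3, 3] : List ℕ), q.Prime := by decide +kernel
  have hg : (2 : ZMod (3 ^ 8)) = -(4 ^ 1094) := by decide +kernel
  have h4 : (4 : ZMod (3 ^ 8)) * 4921 = 1 := by decide +kernel
  haveI : NeZero (3 ^ 8) := ⟨by norm_num⟩
  have hφ : φ (3 ^ 8) = 4374 := by
    rw [Nat.totient_prime_pow (by norm_num) (by norm_num : 0 < 8)]; norm_num
  have h : CuspSpanEvenAtTwo (3 ^ 8) :=
    cuspSpanEvenAtTwo_primePow_of_factorList (p := 3) (by norm_num) 8 2 1094 hg 4921 h4 4374 hφ [2, 3, 3, 3, 3, 3, 3, 3] hL (by norm_num) h2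
  simpa using h

/-- `CuspSpanEvenAtTwo 343` (`343 = 7^3`; Theorem A: `3` has order `φ = 294`, `3 = −4^61` in `ℤ/343`). [cite: Pollack2003, Conj. 6.3] -/
theorem cuspSpanEvenAtTwo_uniform_343 : CuspSpanEvenAtTwo 343 := by
  have h2 : ∀ q ∈ ([2, 3, 7, 7] : List ℕ), (3 : ZMod (7 ^ 3)) ^ (294 / q) ≠ 1 := by decide +kernel
  have hL : ∀ q ∈ ([2, 3, 7, 7] : List ℕ), q.Prime := by decide +kernel
  have hg : (3 : ZMod (7 ^ 3)) = -(4 ^ 61) := by decide +kernel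
  have h4 : (4 : ZMod (7 ^ 3)) * 86 = 1 := by decide +kernel
  haveI : NeZero (7 ^ 3) := ⟨by norm_num⟩
  have hφ : φ (7 ^ 3) = 294 := by
    rw [Nat.totient_prime_pow (by norm_num) (by norm_num : 0 < 3)]; norm_num
  have h : CuspSpanEvenAtTwo (7 ^ 3) :=
    cuspSpanEvenAtTwo_primePow_of_factorList (p := 7) (by norm_num) 3 3 61 hg 86 h4 294 hφ [2, 3, 7, 7] hL (by norm_num) h2
  simpa using h

/-- `CuspSpanEvenAtTwo 2401` (`2401 = 7^4`; Theorem A: `3` has order `φ = 2058`, `3 = −4^208` in `ℤ/2401`). [cite: Pollack2003, Conj. 6.3] -/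
theorem cuspSpanEvenAtTwo_uniform_2401 : CuspSpanEvenAtTwo 2401 := by
  have h2 : ∀ q ∈ ([2, 3, 7, 7, 7] : List ℕ), (3 : ZMod (7 ^ 4)) ^ (2058 / q) ≠ 1 := by decide +kernel
  have hL : ∀ q ∈ ([2, 3, 7, 7, 7] : List ℕ), q.Prime := by decide +kernel
  have hg : (3 : ZMod (7 ^ 4)) = -(4 ^ 208) := by decide +kernel
  have h4 : (4 : ZMod (7 ^ 4)) * 1801 = 1 := by decide +kernel
  haveI : NeZero (7 ^ 4) := ⟨by norm_num⟩
  have hφ : φ (7 ^ 4) = 2058 := by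
    rw [Nat.totient_prime_pow (by norm_num) (by norm_num : 0 < 4)]; norm_num
  have h : CuspSpanEvenAtTwo (7 ^ 4) :=
    cuspSpanEvenAtTwo_primePow_of_factorList (p := 7) (by norm_num) 4 3 208 hg 1801 h4 2058 hφ [2, 3, 7, 7, 7] hL (by norm_num) h2
  simpa using h

/-- `CuspSpanEvenAtTwo 1331` (`1331 = 11^3`; Theorem A: `2` has order `φ = 1210`, `2 = −4^303` in `ℤ/1331`). [cite: Pollack2003, Conj. 6.3] -/
theorem cuspSpanEvenAtTwo_uniform_1331 : CuspSpanEvenAtTwo 1331 := by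
  have h2 : ∀ q ∈ ([2, 5, 11, 11] : List ℕ), (2 : ZMod (11 ^ 3)) ^ (1210 / q) ≠ 1 := by decide +kernel
  have hL : ∀ q ∈ ([2, 5, 11, 11] : List ℕ), q.Prime := by decide +kernel
  have hg : (2 : ZMod (11 ^ 3)) = -(4 ^ 303) := by decide +kernel
  have h4 : (4 : ZMod (11 ^ 3)) * 333 = 1 := by decide +kernel
  haveI : NeZero (11 ^ 3) := ⟨by norm_num⟩
  have hφ : φ (11 ^ 3) = 1210 := by
    rw [Nat.totient_prime_pow (by norm_num) (by norm_num : 0 < 3)]; norm_num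
  have h : CuspSpanEvenAtTwo (11 ^ 3) :=
    cuspSpanEvenAtTwo_primePow_of_factorList (p := 11) (by norm_num) 3 2 303 hg 333 h4 1210 hφ [2, 5, 11, 11] hL (by norm_num) h2
  simpa using h

/-- `CuspSpanEvenAtTwo 529` (`529 = 23^2`; Theorem A: `5` has order `φ = 506`, `5 = −4^179` in `ℤ/529`). [cite: Pollack2003, Conj. 6.3] -/
theorem cuspSpanEvenAtTwo_uniform_529 : CuspSpanEvenAtTwo 529 := by
  have h2 : ∀ q ∈ ([2, 11, 23] : List ℕ), (5 : ZMod (23 ^ 2)) ^ (506 / q) ≠ 1 := by decide +kernel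
  have hL : ∀ q ∈ ([2, 11, 23] : List ℕ), q.Prime := by decide +kernel
  have hg : (5 : ZMod (23 ^ 2)) = -(4 ^ 179) := by decide +kernel
  have h4 : (4 : ZMod (23 ^ 2)) * 397 = 1 := by decide +kernel
  haveI : NeZero (23 ^ 2) := ⟨by norm_num⟩
  have hφ : φ (23 ^ 2) = 506 := by
    rw [Nat.totient_prime_pow (by norm_num) (by norm_num : 0 < 2)]; norm_num
  have h : CuspSpanEvenAtTwo (23 ^ 2) :=
    cuspSpanEvenAtTwo_primePow_of_factorList (p := 23) (by norm_num) 2 5 179 hg 397 h4 506 hφ [2, 11, 23] hL (by norm_num) h2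
  simpa using h

/-- `CuspSpanEvenAtTwo 2209` (`2209 = 47^2`; Theorem A: `5` has order `φ = 2162`, `5 = −4^384` in `ℤ/2209`). [cite: Pollack2003, Conj. 6.3] -/
theorem cuspSpanEvenAtTwo_uniform_2209 : CuspSpanEvenAtTwo 2209 := by
  have h2 : ∀ q ∈ ([2, 23, 47] : List ℕ), (5 : ZMod (47 ^ 2)) ^ (2162 / q) ≠ 1 := by decide +kernel
  have hL : ∀ q ∈ ([2, 23, 47] : List ℕ), q.Prime := by decide +kernel
  have hg : (5 : ZMod (47 ^ 2)) = -(4 ^ 384) := by decide +kernel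
  have h4 : (4 : ZMod (47 ^ 2)) * 1657 = 1 := by decide +kernel
  haveI : NeZero (47 ^ 2) := ⟨by norm_num⟩
  have hφ : φ (47 ^ 2) = 2162 := by
    rw [Nat.totient_prime_pow (by norm_num) (by norm_num : 0 < 2)]; norm_num
  have h : CuspSpanEvenAtTwo (47 ^ 2) :=
    cuspSpanEvenAtTwo_primePow_of_factorList (p := 47) (by norm_num) 2 5 384 hg 1657 h4 2162 hφ [2, 23, 47] hL (by norm_num) h2
  simpa using h

/-- `CuspSpanEvenAtTwo 3481` (`3481 = 59^2`; Theorem A: `2` has order `φ = 3422`, `2 = −4^856` in `ℤ/3481`). [cite: Pollack2003, Conj. 6.3] -/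
theorem cuspSpanEvenAtTwo_uniform_3481 : CuspSpanEvenAtTwo 3481 := by
  have h2 : ∀ q ∈ ([2, 29, 59] : List ℕ), (2 : ZMod (59 ^ 2)) ^ (3422 / q) ≠ 1 := by decide +kernel
  have hL : ∀ q ∈ ([2, 29, 59] : List ℕ), q.Prime := by decide +kernel
  have hg : (2 : ZMod (59 ^ 2)) = -(4 ^ 856) := by decide +kernel
  have h4 : (4 : ZMod (59 ^ 2)) * 2611 = 1 := by decide +kernel
  haveI : NeZero (59 ^ 2) := ⟨by norm_num⟩
  have hφ : φ (59 ^ 2) = 3422 := by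
    rw [Nat.totient_prime_pow (by norm_num) (by norm_num : 0 < 2)]; norm_num
  have h : CuspSpanEvenAtTwo (59 ^ 2) :=
    cuspSpanEvenAtTwo_primePow_of_factorList (p := 59) (by norm_num) 2 2 856 hg 2611 h4 3422 hφ [2, 29, 59] hL (by norm_num) h2
  simpa using h

/-- `CuspSpanEvenAtTwo 4489` (`4489 = 67^2`; Theorem A: `2` has order `φ = 4422`, `2 = −4^1106` in `ℤ/4489`). [cite: Pollack2003, Conj. 6.3] -/
theorem cuspSpanEvenAtTwo_uniform_4489 : CuspSpanEvenAtTwo 4489 := by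
  have h2 : ∀ q ∈ ([2, 3, 11, 67] : List ℕ), (2 : ZMod (67 ^ 2)) ^ (4422 / q) ≠ 1 := by decide +kernel
  have hL : ∀ q ∈ ([2, 3, 11, 67] : List ℕ), q.Prime := by decide +kernel
  have hg : (2 : ZMod (67 ^ 2)) = -(4 ^ 1106) := by decide +kernel
  have h4 : (4 : ZMod (67 ^ 2)) * 3367 = 1 := by decide +kernel
  haveI : NeZero (67 ^ 2) := ⟨by norm_num⟩
  have hφ : φ (67 ^ 2) = 4422 := by
    rw [Nat.totient_prime_pow (by norm_num) (by norm_num : 0 < 2)]; norm_num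
  have h : CuspSpanEvenAtTwo (67 ^ 2) :=
    cuspSpanEvenAtTwo_primePow_of_factorList (p := 67) (by norm_num) 2 2 1106 hg 3367 h4 4422 hφ [2, 3, 11, 67] hL (by norm_num) h2
  simpa using h

/-- `CuspSpanEvenAtTwo 5041` (`5041 = 71^2`; Theorem A: `7` has order `φ = 4970`, `7 = −4^2313` in `ℤ/5041`). [cite: Pollack2003, Conj. 6.3] -/
theorem cuspSpanEvenAtTwo_uniform_5041 : CuspSpanEvenAtTwo 5041 := by
  have h2 : ∀ q ∈ ([2, 5, 7, 71] : List ℕ), (7 : ZMod (71 ^ 2)) ^ (4970 / q) ≠ 1 := by decide +kernel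
  have hL : ∀ q ∈ ([2, 5, 7, 71] : List ℕ), q.Prime := by decide +kernel
  have hg : (7 : ZMod (71 ^ 2)) = -(4 ^ 2313) := by decide +kernel
  have h4 : (4 : ZMod (71 ^ 2)) * 3781 = 1 := by decide +kernel
  haveI : NeZero (71 ^ 2) := ⟨by norm_num⟩
  have hφ : φ (71 ^ 2) = 4970 := by
    rw [Nat.totient_prime_pow (by norm_num) (by norm_num : 0 < 2)]; norm_num
  have h : CuspSpanEvenAtTwo (71 ^ 2) :=
    cuspSpanEvenAtTwo_primePow_of_factorList (p := 71) (by norm_num) 2 7 2313 hg 3781 h4 4970 hφ [2, 5, 7, 71] hL (by norm_num) h2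
  simpa using h

/-- `CuspSpanEvenAtTwo 6241` (`6241 = 79^2`; Theorem A: `3` has order `φ = 6162`, `3 = −4^122` in `ℤ/6241`). [cite: Pollack2003, Conj. 6.3] -/
theorem cuspSpanEvenAtTwo_uniform_6241 : CuspSpanEvenAtTwo 6241 := by
  have h2 : ∀ q ∈ ([2, 3, 13, 79] : List ℕ), (3 : ZMod (79 ^ 2)) ^ (6162 / q) ≠ 1 := by decide +kernel
  have hL : ∀ q ∈ ([2, 3, 13, 79] : List ℕ), q.Prime := by decide +kernel
  have hg : (3 : ZMod (79 ^ 2)) = -(4 ^ 122) := by decide +kernel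
  have h4 : (4 : ZMod (79 ^ 2)) * 4681 = 1 := by decide +kernel
  haveI : NeZero (79 ^ 2) := ⟨by norm_num⟩
  have hφ : φ (79 ^ 2) = 6162 := by
    rw [Nat.totient_prime_pow (by norm_num) (by norm_num : 0 < 2)]; norm_num
  have h : CuspSpanEvenAtTwo (79 ^ 2) :=
    cuspSpanEvenAtTwo_primePow_of_factorList (p := 79) (by norm_num) 2 3 122 hg 4681 h4 6162 hφ [2, 3, 13, 79] hL (by norm_num) h2
  simpa using h

/-- `CuspSpanEvenAtTwo 6859` (`6859 = 19^3`; Theorem A: `2` has order `φ = 6498`, `2 = −4^1625` in `ℤ/6859`). [cite: Pollack2003, Conj. 6.3] -/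
theorem cuspSpanEvenAtTwo_uniform_6859 : CuspSpanEvenAtTwo 6859 := by
  have h2 : ∀ q ∈ ([2, 3, 3, 19, 19] : List ℕ), (2 : ZMod (19 ^ 3)) ^ (6498 / q) ≠ 1 := by decide +kernel
  have hL : ∀ q ∈ ([2, 3, 3, 19, 19] : List ℕ), q.Prime := by decide +kernel
  have hg : (2 : ZMod (19 ^ 3)) = -(4 ^ 1625) := by decide +kernel
  have h4 : (4 : ZMod (19 ^ 3)) * 1715 = 1 := by decide +kernel
  haveI : NeZero (19 ^ 3) := ⟨by norm_num⟩
  have hφ : φ (19 ^ 3) = 6498 := by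
    rw [Nat.totient_prime_pow (by norm_num) (by norm_num : 0 < 3)]; norm_num
  have h : CuspSpanEvenAtTwo (19 ^ 3) :=
    cuspSpanEvenAtTwo_primePow_of_factorList (p := 19) (by norm_num) 3 2 1625 hg 1715 h4 6498 hφ [2, 3, 3, 19, 19] hL (by norm_num) h2
  simpa using h

/-- `CuspSpanEvenAtTwo 6889` (`6889 = 83^2`; Theorem A: `2` has order `φ = 6806`, `2 = −4^1702` in `ℤ/6889`). [cite: Pollack2003, Conj. 6.3] -/
theorem cuspSpanEvenAtTwo_uniform_6889 : CuspSpanEvenAtTwo 6889 := by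
  have h2 : ∀ q ∈ ([2, 41, 83] : List ℕ), (2 : ZMod (83 ^ 2)) ^ (6806 / q) ≠ 1 := by decide +kernel
  have hL : ∀ q ∈ ([2, 41, 83] : List ℕ), q.Prime := by decide +kernel
  have hg : (2 : ZMod (83 ^ 2)) = -(4 ^ 1702) := by decide +kernel
  have h4 : (4 : ZMod (83 ^ 2)) * 5167 = 1 := by decide +kernel
  haveI : NeZero (83 ^ 2) := ⟨by norm_num⟩
  have hφ : φ (83 ^ 2) = 6806 := by
    rw [Nat.totient_prime_pow (by norm_num) (by norm_num : 0 < 2)]; norm_num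
  have h : CuspSpanEvenAtTwo (83 ^ 2) :=
    cuspSpanEvenAtTwo_primePow_of_factorList (p := 83) (by norm_num) 2 2 1702 hg 5167 h4 6806 hφ [2, 41, 83] hL (by norm_num) h2
  simpa using h

end Summit.BirchSwinnertonDyer.BirchSwinnertonDyer.Theorems.SignedMuAtTwo

end
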